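import Summits.Ventures.PercRepro.RLSRuleTwoLinesSixGeom

/-!
# C-025 at q = 3: the `6`-point planes with two `3`-point lines — the supply in abstract witness sums (night-3, gen 4)

For `G` with `|G| = 6`, two `3`-point lines `ℓ, ℓ′` (`TwoLinesAny`), `c = |ℓ ∩ ℓ′|`, in the UNIT witness sums of an
independent `K ⊆ E ∖ G` (`T_b = Σ_X 1/C(b + |X|, 3)`, `W = Σ_X 1`, the loss sums `L_b = Σ_j C(N, j)/C(b + j + 3, 3)`,
`L_W = Σ_j C(N, j)` with `|K| = N + 3`):

* `twoLinesSix_supply` — both lines charged their `(L3)` loss (`Λ = {ℓ, ℓ′}`):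
  `18T₀ + 6(3T₁ − 3L₁) + 36T₁ + c(8T₂ − 16L₂) + 2(3 − c)(9T₂ − 9L₂) + 10c·T₂ + (W − 2L_W) ≤ Σ_{S ∈ Yq} w⁺(G, S)`;
* `twoLinesSix_supply_free` — no loss (`Λ = ∅`): `18T₀ + 54T₁ + 54T₂ + W ≤ Σ_{S ∈ Yq} w⁺(G, S)` (the `5`-set
  weights `8c + 18(3 − c) + 10c = 54` do not depend on `c`).
Imports `RLSRuleTwoLinesSixGeom`.  Axioms: standard.
-/

open scoped Matroid

namespace PercRepro

namespace NightThree

open Finset ThmH PerFlat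

variable {α : Type*} [DecidableEq α] {M : Matroid α} [M.Finite]

open scoped Classical in
/-- **The profile accounting of a `6`-point plane with two lines, both charged.** -/
theorem twoLinesSix_supply {p : ℕ} (hc : Core M p) {G ℓ ℓ' K C₀ C₁ : Finset α} {n N : ℕ} (hG : G ∈ flatsQ M 3)
    (h : TwoLinesAny M G ℓ ℓ') (hGc : G.card = 6) (hKsub : K ⊆ gr M \ G) (hKind : M.Indep (K : Set α))
    (hK : K.card = N + 3) (hn : 2 ≤ n) (hC₀ : C₀ ⊆ K) (hC₀c : C₀.card = 3) (hC₁ : C₁ ⊆ K) (hC₁c : C₁.card = 3)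
    (hgood₀ : ∀ X, ¬ C₀ ⊆ X → GoodWitness M ℓ K X) (hgood₁ : ∀ X, ¬ C₁ ⊆ X → GoodWitness M ℓ' K X) :
    18 * (∑ X ∈ witnessFamily K n, 1 / (((3 + X.card).choose 3 : ℕ) : ℚ))
    + 6 * (3 * (∑ X ∈ witnessFamily K n, 1 / (((4 + X.card).choose 3 : ℕ) : ℚ))
        - 3 * ∑ j ∈ range (n - 2), (N.choose j : ℚ) * (1 / (((4 + (j + 3)).choose 3 : ℕ) : ℚ)))
    + 36 * (∑ X ∈ witnessFamily K n, 1 / (((4 + X.card).choose 3 : ℕ) : ℚ))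
    + ((ℓ ∩ ℓ').card : ℚ) * (8 * (∑ X ∈ witnessFamily K n, 1 / (((5 + X.card).choose 3 : ℕ) : ℚ))
        - 16 * ∑ j ∈ range (n - 2), (N.choose j : ℚ) * (1 / (((5 + (j + 3)).choose 3 : ℕ) : ℚ)))
    + 2 * (3 - ((ℓ ∩ ℓ').card : ℚ)) * (9 * (∑ X ∈ witnessFamily K n, 1 / (((5 + X.card).choose 3 : ℕ) : ℚ))
        - 9 * ∑ j ∈ range (n - 2), (N.choose j : ℚ) * (1 / (((5 + (j + 3)).choose 3 : ℕ) : ℚ)))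
    + 10 * ((ℓ ∩ ℓ').card : ℚ) * (∑ X ∈ witnessFamily K n, 1 / (((5 + X.card).choose 3 : ℕ) : ℚ))
    + (∑ _X ∈ witnessFamily K n, (1 : ℚ) - 2 * ∑ j ∈ range (n - 2), (N.choose j : ℚ) * (1 : ℚ))
    ≤ ∑ S ∈ Yq M (n + 4) 3, wPlus M G S := by
  obtain ⟨hmem3, h𝔅rank, hd34, hd5, hd6, hc3, hc4, hc5⟩ := twoLinesSix_family hc hG h hGc
  have hdep : depTriples M G = {ℓ, ℓ'} := depTriples_eq_pair_of_twoLinesAny h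
  have hmeet := card_inter_le_one_of_twoLines' hG h
  obtain ⟨hℓG, hℓ'G, hℓc, hℓ'c, hℓr, hℓ'r, hne, hsimple, hind⟩ := h
  have h' : TwoLinesAny M G ℓ ℓ' := ⟨hℓG, hℓ'G, hℓc, hℓ'c, hℓr, hℓ'r, hne, hsimple, hind⟩
  set C : Finset α → Finset α := fun m => if m = ℓ then C₀ else C₁ with hCdef
  have hCℓ : C ℓ = C₀ := by rw [hCdef]; simp
  have hCℓ' : C ℓ' = C₁ := by rw [hCdef]; simp [hne.symm]
  set Λ : Finset (Finset α) := {ℓ, ℓ'} with hΛdef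
  have hsup := supply_ge_profile hc hG hKsub hKind n Λ
    (fun m hm hnot => by rw [hdep] at hm; exact absurd hm hnot) C
    (fun m hm X hX => by
      rw [hΛdef, Finset.mem_insert, Finset.mem_singleton] at hm
      rcases hm with rfl | rfl
      · rw [hCℓ] at hX; exact hgood₀ X hX
      · rw [hCℓ'] at hX; exact hgood₁ X hX) h𝔅rank
  refine le_trans ?_ hsup
  set f : Finset α → Finset α → ℚ := fun B X =>
    if ∀ m ∈ Λ, m ⊆ B → ¬ C m ⊆ X then profileShare M B X else 0 with hf
  -- the condition on a subset `B` in terms of the lines it contains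
  have hcond : ∀ B X, (∀ m ∈ Λ, m ⊆ B → ¬ C m ⊆ X) ↔ (ℓ ⊆ B → ¬ C₀ ⊆ X) ∧ (ℓ' ⊆ B → ¬ C₁ ⊆ X) := by
    intro B X
    rw [hΛdef]
    simp only [Finset.mem_insert, Finset.mem_singleton, forall_eq_or_imp, forall_eq, hCℓ, hCℓ']
  have hC' : ∀ Λ' ⊆ Λ, ∀ m ∈ Λ', C m ⊆ K ∧ (C m).card = 3 := by
    intro Λ' hΛ' m hm
    have := hΛ' hm
    rw [hΛdef, Finset.mem_insert, Finset.mem_singleton] at this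
    rcases this with rfl | rfl
    · rw [hCℓ]; exact ⟨hC₀, hC₀c⟩
    · rw [hCℓ']; exact ⟨hC₁, hC₁c⟩
  -- generic evaluation of `f B X` when the charged lines inside `B` form `Λ'`
  have hfval : ∀ B X (Λ' : Finset (Finset α)), (∀ m, m ∈ Λ' ↔ m ∈ Λ ∧ m ⊆ B) →
      f B X = (if ∀ m ∈ Λ', ¬ C m ⊆ X then profileShare M B X else 0) := by
    intro B X Λ' hΛ'
    rw [hf]
    dsimp only
    have : (∀ m ∈ Λ, m ⊆ B → ¬ C m ⊆ X) ↔ (∀ m ∈ Λ', ¬ C m ⊆ X) := by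
      constructor
      · intro hh m hm; exact hh m ((hΛ' m).1 hm).1 ((hΛ' m).1 hm).2
      · intro hh m hm hmB; exact hh m ((hΛ' m).2 ⟨hm, hmB⟩)
    by_cases hg : ∀ m ∈ Λ', ¬ C m ⊆ X
    · rw [if_pos (this.2 hg), if_pos hg]
    · rw [if_neg (fun hh => hg (this.1 hh)), if_neg hg]
  -- the profile share on each kind of subset
  have hshare3 : ∀ B ∈ ((G.powersetCard 3).erase ℓ).erase ℓ', ∀ X,
      profileShare M B X = 1 / (((3 + X.card).choose 3 : ℕ) : ℚ) := by
    intro B hB X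
    obtain ⟨hBG, hBc, hl, hl', _⟩ := hmem3 B hB
    unfold profileShare
    rw [if_pos (by omega), rho3_of_twoLines' h' hBG, hBc]
    simp only [if_neg hl, if_neg hl', Nat.choose_self, Nat.sub_zero, Nat.cast_one]
  have hshare4 : ∀ B ∈ G.powersetCard 4, ∀ X, profileShare M B X =
      ((4 - (if ℓ ⊆ B then 1 else 0) - (if ℓ' ⊆ B then 1 else 0) : ℕ) : ℚ) / (((4 + X.card).choose 3 : ℕ) : ℚ) := by
    intro B hB X
    obtain ⟨hBG, hBc⟩ := Finset.mem_powersetCard.1 hB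
    unfold profileShare
    rw [if_pos (by omega), rho3_of_twoLines' h' hBG, hBc, show Nat.choose 4 3 = 4 by norm_num [Nat.choose]]
  have hshare5 : ∀ B ∈ G.powersetCard 5, ∀ X, profileShare M B X =
      ((10 - (if ℓ ⊆ B then 1 else 0) - (if ℓ' ⊆ B then 1 else 0) : ℕ) : ℚ) / (((5 + X.card).choose 3 : ℕ) : ℚ) := by
    intro B hB X
    obtain ⟨hBG, hBc⟩ := Finset.mem_powersetCard.1 hB
    unfold profileShare
    rw [if_pos (by omega), rho3_of_twoLines' h' hBG, hBc, show Nat.choose 5 3 = 10 by norm_num [Nat.choose]]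
  have hshare6 : ∀ X, profileShare M G X = 1 := by
    intro X; unfold profileShare; rw [if_neg (by omega)]
  -- the pieces
  have h3 : ∑ B ∈ ((G.powersetCard 3).erase ℓ).erase ℓ', ∑ X ∈ witnessFamily K n, f B X =
      18 * (∑ X ∈ witnessFamily K n, 1 / (((3 + X.card).choose 3 : ℕ) : ℚ)) := by
    have hval : ∀ B ∈ ((G.powersetCard 3).erase ℓ).erase ℓ', ∑ X ∈ witnessFamily K n, f B X =
        ∑ X ∈ witnessFamily K n, 1 / (((3 + X.card).choose 3 : ℕ) : ℚ) := by
      intro B hB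
      obtain ⟨_, _, hl, hl', _⟩ := hmem3 B hB
      apply Finset.sum_congr rfl
      intro X _
      rw [hfval B X ∅ (fun m => by
        simp only [Finset.notMem_empty, false_iff, not_and]
        intro hm hmB
        rw [hΛdef, Finset.mem_insert, Finset.mem_singleton] at hm
        rcases hm with rfl | rfl
        · exact hl hmB
        · exact hl' hmB)]
      rw [if_pos (fun m hm => absurd hm (Finset.notMem_empty m)), hshare3 B hB X]
    rw [Finset.sum_congr rfl hval, Finset.sum_const, hc3, nsmul_eq_mul]
    norm_num
  -- the charged sums: `Λ′ = {ℓ}`, `{ℓ′}`, `{ℓ, ℓ′}` with a share `g`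
  have hΛℓ : ∀ B, ℓ ⊆ B → ¬ ℓ' ⊆ B → ∀ m, m ∈ ({ℓ} : Finset (Finset α)) ↔ m ∈ Λ ∧ m ⊆ B := by
    intro B hl hl' m
    rw [hΛdef, Finset.mem_singleton, Finset.mem_insert, Finset.mem_singleton]
    constructor
    · rintro rfl; exact ⟨Or.inl rfl, hl⟩
    · rintro ⟨hm | hm, hmB⟩
      · exact hm
      · rw [hm] at hmB; exact absurd hmB hl'
  have hΛℓ' : ∀ B, ¬ ℓ ⊆ B → ℓ' ⊆ B → ∀ m, m ∈ ({ℓ'} : Finset (Finset α)) ↔ m ∈ Λ ∧ m ⊆ B := by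
    intro B hl hl' m
    rw [hΛdef, Finset.mem_singleton, Finset.mem_insert, Finset.mem_singleton]
    constructor
    · rintro rfl; exact ⟨Or.inr rfl, hl'⟩
    · rintro ⟨hm | hm, hmB⟩
      · rw [hm] at hmB; exact absurd hmB hl
      · exact hm
  have hΛboth : ∀ B, ℓ ⊆ B → ℓ' ⊆ B → ∀ m, m ∈ Λ ↔ m ∈ Λ ∧ m ⊆ B := by
    intro B hl hl' m
    constructor
    · intro hm
      refine ⟨hm, ?_⟩
      rw [hΛdef, Finset.mem_insert, Finset.mem_singleton] at hm
      rcases hm with rfl | rfl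
      · exact hl
      · exact hl'
    · exact fun hm => hm.1
  have hΛnone : ∀ B, ¬ ℓ ⊆ B → ¬ ℓ' ⊆ B → ∀ m, m ∈ (∅ : Finset (Finset α)) ↔ m ∈ Λ ∧ m ⊆ B := by
    intro B hl hl' m
    simp only [Finset.notMem_empty, false_iff, not_and]
    intro hm hmB
    rw [hΛdef, Finset.mem_insert, Finset.mem_singleton] at hm
    rcases hm with rfl | rfl
    · exact hl hmB
    · exact hl' hmB
  -- abbreviations for the charged witness sums
  set g4 : ℕ → ℚ := fun x => 3 / (((4 + x).choose 3 : ℕ) : ℚ) with hg4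
  set g5a : ℕ → ℚ := fun x => 8 / (((5 + x).choose 3 : ℕ) : ℚ) with hg5a
  set g5b : ℕ → ℚ := fun x => 9 / (((5 + x).choose 3 : ℕ) : ℚ) with hg5b
  set gW : ℕ → ℚ := fun _ => (1 : ℚ) with hgW
  have hsub₁ : ({ℓ} : Finset (Finset α)) ⊆ Λ := by
    intro m hm; rw [Finset.mem_singleton] at hm; rw [hm, hΛdef]; exact Finset.mem_insert_self _ _
  have hsub₂ : ({ℓ'} : Finset (Finset α)) ⊆ Λ := by
    intro m hm; rw [Finset.mem_singleton] at hm; rw [hm, hΛdef]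
    exact Finset.mem_insert_of_mem (Finset.mem_singleton_self _)
  have h4 : ∑ B ∈ G.powersetCard 4, ∑ X ∈ witnessFamily K n, f B X =
      3 * (∑ X ∈ witnessFamily K n, (if ∀ m ∈ ({ℓ} : Finset (Finset α)), ¬ C m ⊆ X then g4 X.card else 0))
      + 3 * (∑ X ∈ witnessFamily K n, (if ∀ m ∈ ({ℓ'} : Finset (Finset α)), ¬ C m ⊆ X then g4 X.card else 0))
      + 9 * (∑ X ∈ witnessFamily K n, 4 / (((4 + X.card).choose 3 : ℕ) : ℚ)) := by
    have hnb : ∀ B ∈ G.powersetCard 4, ¬ (ℓ ⊆ B ∧ ℓ' ⊆ B) := by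
      rintro B hB ⟨hl, hl'⟩
      have hu := Finset.card_union_add_card_inter ℓ ℓ'
      have := Finset.card_le_card (Finset.union_subset hl hl')
      rw [(Finset.mem_powersetCard.1 hB).2] at this
      omega
    apply sum_powersetCard_four_twoSix hG h' hGc
    · intro B hB hl
      have hl' : ¬ ℓ' ⊆ B := fun hl' => hnb B hB ⟨hl, hl'⟩
      apply Finset.sum_congr rfl
      intro X _
      rw [hfval B X _ (hΛℓ B hl hl'), hshare4 B hB X]
      simp only [if_pos hl, if_neg hl', hg4]
      split_ifs <;> norm_num
    · intro B hB hl'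
      have hl : ¬ ℓ ⊆ B := fun hl => hnb B hB ⟨hl, hl'⟩
      apply Finset.sum_congr rfl
      intro X _
      rw [hfval B X _ (hΛℓ' B hl hl'), hshare4 B hB X]
      simp only [if_neg hl, if_pos hl', hg4]
      split_ifs <;> norm_num
    · intro B hB hl hl'
      apply Finset.sum_congr rfl
      intro X _
      rw [hfval B X _ (hΛnone B hl hl'), if_pos (fun m hm => absurd hm (Finset.notMem_empty m)), hshare4 B hB X]
      simp only [if_neg hl, if_neg hl', Nat.sub_zero]
      norm_num
  have h5 : ∑ B ∈ G.powersetCard 5, ∑ X ∈ witnessFamily K n, f B X =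
      ((ℓ ∩ ℓ').card : ℚ) * (∑ X ∈ witnessFamily K n, (if ∀ m ∈ Λ, ¬ C m ⊆ X then g5a X.card else 0))
      + (3 - ((ℓ ∩ ℓ').card : ℚ)) * (∑ X ∈ witnessFamily K n,
          (if ∀ m ∈ ({ℓ} : Finset (Finset α)), ¬ C m ⊆ X then g5b X.card else 0))
      + (3 - ((ℓ ∩ ℓ').card : ℚ)) * (∑ X ∈ witnessFamily K n,
          (if ∀ m ∈ ({ℓ'} : Finset (Finset α)), ¬ C m ⊆ X then g5b X.card else 0))
      + ((ℓ ∩ ℓ').card : ℚ) * (∑ X ∈ witnessFamily K n, 10 / (((5 + X.card).choose 3 : ℕ) : ℚ)) := by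
    apply sum_powersetCard_five_twoSix hG h' hGc
    · intro B hB hl hl'
      apply Finset.sum_congr rfl
      intro X _
      rw [hfval B X _ (hΛboth B hl hl'), hshare5 B hB X]
      simp only [if_pos hl, if_pos hl', hg5a]
      split_ifs <;> norm_num
    · intro B hB hl hl'
      apply Finset.sum_congr rfl
      intro X _
      rw [hfval B X _ (hΛℓ B hl hl'), hshare5 B hB X]
      simp only [if_pos hl, if_neg hl', hg5b]
      split_ifs <;> norm_num
    · intro B hB hl hl'
      apply Finset.sum_congr rfl
      intro X _
      rw [hfval B X _ (hΛℓ' B hl hl'), hshare5 B hB X]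
      simp only [if_neg hl, if_pos hl', hg5b]
      split_ifs <;> norm_num
    · intro B hB hl hl'
      apply Finset.sum_congr rfl
      intro X _
      rw [hfval B X _ (hΛnone B hl hl'), if_pos (fun m hm => absurd hm (Finset.notMem_empty m)), hshare5 B hB X]
      simp only [if_neg hl, if_neg hl', Nat.sub_zero]
      norm_num
  have h6 : ∑ X ∈ witnessFamily K n, f G X =
      ∑ X ∈ witnessFamily K n, (if ∀ m ∈ Λ, ¬ C m ⊆ X then gW X.card else 0) := by
    apply Finset.sum_congr rfl
    intro X _
    rw [hfval G X _ (hΛboth G hℓG hℓ'G), hshare6 X]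
  -- the union bounds
  have hb4 := sum_good_ge_sub hn hK ({ℓ} : Finset (Finset α)) C (hC' _ hsub₁) g4 (fun _ => by positivity)
  have hb4' := sum_good_ge_sub hn hK ({ℓ'} : Finset (Finset α)) C (hC' _ hsub₂) g4 (fun _ => by positivity)
  have hb5a := sum_good_ge_sub hn hK Λ C (hC' _ le_rfl) g5a (fun _ => by positivity)
  have hb5 := sum_good_ge_sub hn hK ({ℓ} : Finset (Finset α)) C (hC' _ hsub₁) g5b (fun _ => by positivity)
  have hb5' := sum_good_ge_sub hn hK ({ℓ'} : Finset (Finset α)) C (hC' _ hsub₂) g5b (fun _ => by positivity)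
  have hbW := sum_good_ge_sub hn hK Λ C (hC' _ le_rfl) gW (fun _ => by positivity)
  have hΛc : Λ.card = 2 := by rw [hΛdef, Finset.card_pair hne]
  rw [Finset.card_singleton, Nat.cast_one, one_mul] at hb4 hb4' hb5 hb5'
  rw [hΛc] at hb5a hbW
  push_cast at hb5a hbW
  -- unit sums
  have e4 : ∑ X ∈ witnessFamily K n, g4 X.card = 3 * ∑ X ∈ witnessFamily K n, 1 / (((4 + X.card).choose 3 : ℕ) : ℚ) := by
    rw [Finset.mul_sum]; apply Finset.sum_congr rfl; intro X _; rw [hg4]; ring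
  have e4' : ∑ X ∈ witnessFamily K n, 4 / (((4 + X.card).choose 3 : ℕ) : ℚ) =
      4 * ∑ X ∈ witnessFamily K n, 1 / (((4 + X.card).choose 3 : ℕ) : ℚ) := by
    rw [Finset.mul_sum]; apply Finset.sum_congr rfl; intro X _; ring
  have e5a : ∑ X ∈ witnessFamily K n, g5a X.card = 8 * ∑ X ∈ witnessFamily K n, 1 / (((5 + X.card).choose 3 : ℕ) : ℚ) := by
    rw [Finset.mul_sum]; apply Finset.sum_congr rfl; intro X _; rw [hg5a]; ring
  have e5b : ∑ X ∈ witnessFamily K n, g5b X.card = 9 * ∑ X ∈ witnessFamily K n, 1 / (((5 + X.card).choose 3 : ℕ) : ℚ) := by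
    rw [Finset.mul_sum]; apply Finset.sum_congr rfl; intro X _; rw [hg5b]; ring
  have e5' : ∑ X ∈ witnessFamily K n, 10 / (((5 + X.card).choose 3 : ℕ) : ℚ) =
      10 * ∑ X ∈ witnessFamily K n, 1 / (((5 + X.card).choose 3 : ℕ) : ℚ) := by
    rw [Finset.mul_sum]; apply Finset.sum_congr rfl; intro X _; ring
  have eW : ∑ X ∈ witnessFamily K n, gW X.card = ∑ _X ∈ witnessFamily K n, (1 : ℚ) := by
    apply Finset.sum_congr rfl; intro X _; rw [hgW]
  have l4 : ∑ j ∈ range (n - 2), (N.choose j : ℚ) * g4 (j + 3) =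
      3 * ∑ j ∈ range (n - 2), (N.choose j : ℚ) * (1 / (((4 + (j + 3)).choose 3 : ℕ) : ℚ)) := by
    rw [Finset.mul_sum]; apply Finset.sum_congr rfl; intro j _; rw [hg4]; ring
  have l5a : ∑ j ∈ range (n - 2), (N.choose j : ℚ) * g5a (j + 3) =
      8 * ∑ j ∈ range (n - 2), (N.choose j : ℚ) * (1 / (((5 + (j + 3)).choose 3 : ℕ) : ℚ)) := by
    rw [Finset.mul_sum]; apply Finset.sum_congr rfl; intro j _; rw [hg5a]; ring
  have l5b : ∑ j ∈ range (n - 2), (N.choose j : ℚ) * g5b (j + 3) =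
      9 * ∑ j ∈ range (n - 2), (N.choose j : ℚ) * (1 / (((5 + (j + 3)).choose 3 : ℕ) : ℚ)) := by
    rw [Finset.mul_sum]; apply Finset.sum_congr rfl; intro j _; rw [hg5b]; ring
  have lW : ∑ j ∈ range (n - 2), (N.choose j : ℚ) * gW (j + 3) = ∑ j ∈ range (n - 2), (N.choose j : ℚ) * (1 : ℚ) := by
    apply Finset.sum_congr rfl; intro j _; rw [hgW]
  rw [e4, l4] at hb4 hb4'
  rw [e5a, l5a] at hb5a
  rw [e5b, l5b] at hb5 hb5'
  rw [eW, lW] at hbW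
  rw [Finset.sum_union hd6, Finset.sum_union hd5, Finset.sum_union hd34, Finset.sum_singleton, h3, h4, h5, h6, e4', e5']
  rcases Nat.le_one_iff_eq_zero_or_eq_one.1 hmeet with hc0 | hc1
  · rw [hc0]
    push_cast
    linarith [hb4, hb4', hb5a, hb5, hb5', hbW]
  · rw [hc1]
    push_cast
    linarith [hb4, hb4', hb5a, hb5, hb5', hbW]

end NightThree

end PercRepro
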